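import Summits.RiemannHypothesis.RiemannHypothesis.Theorems.HandoffCapSharp
import Summits.RiemannHypothesis.RiemannHypothesis.Theorems.HandoffOffDiag
import Literature.NumberTheory.LFunctions.WeilGroundEnergyParitySplit
import Literature.NumberTheory.LFunctions.WeilArchimedeanMoments
import Literature.NumberTheory.LFunctions.WeilWindowSimpleEven
import HarnessLib

/-!
# HANDOFF — a bump, its symmetric pair and its autocorrelation `φ = ψ ⋆ ψ̃` as Weil test functions (cell rh-explicit, TRACK «HANDOFF», seat theory-2; file A1)

HONEST FRAMING. Nothing here bears on RH; RH-free bookkeeping in the tree's normalisation (`WeilExplicit.lean`) for the prime-side Lemma L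
(`HandoffDipoleChebyshev.lean` = file A2, `HandoffChebyshevMellin.lean`, `HandoffBottomDropProof.lean`): for a bump `ψ` (`ContDiffBump 0`, radius `r`)
the complexified bump and the symmetric pair `ψ(· − L/2) + ψ(· + L/2)` are Weil test functions with the stated supports and `L²` masses (§1); the
autocorrelation `φ = ψ ⋆ ψ̃` is the real, even, narrow (`tsupport φ ⊆ [−2r, 2r]`) function `φ(x) = ∫ψ(u)ψ(u − x)du`, and the kernel of the pair is
`2φ + φ(· − L) + φ(· + L)` (§2). Split off file A (p354701, withdrawn: its `local notation`s would have sent it to review) with the notations expanded.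

References: E. Bombieri, Rend. Mat. Acc. Lincei (9) 11 (2000) §2–§4 (`Bombieri2000Weil`).
-/

set_option linter.dupNamespace false  -- the mandated namespace repeats `RiemannHypothesis`

noncomputable section

open Set Filter Complex MeasureTheory Literature.NumberTheory.LFunctions
open Literature.Analysis.SpecialFunctions (reDigammaQuarter)
open Summit.RiemannHypothesis.RiemannHypothesis.Theorems.Handoff
open Summit.RiemannHypothesis.RiemannHypothesis.Theorems.HandoffCapSharp
open scoped Real ComplexConjugate ArithmeticFunction.vonMangoldt

namespace Summit.RiemannHypothesis.RiemannHypothesis.Theorems.HandoffBumpAutocorr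

variable (ψ : ContDiffBump (0 : ℝ)) {L : ℝ}

/-! ## §1  The bump and the symmetric pair as test functions; support; `L²` mass -/

/-- The complexified bump is a Weil test function. [folklore] -/
theorem isWeilTest_bump : IsWeilTest (fun x : ℝ ↦ ((ψ x : ℝ) : ℂ)) :=
  ⟨Complex.ofRealCLM.contDiff.comp ψ.contDiff, ψ.hasCompactSupport.comp_left Complex.ofReal_zero⟩

/-- Its support is the closed ball of radius `r_out`: `tsupport ⊆ [−r_out, r_out]`. [folklore] -/
theorem tsupport_bump_subset : tsupport (fun x : ℝ ↦ ((ψ x : ℝ) : ℂ)) ⊆ Icc (-ψ.rOut) ψ.rOut := by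
  refine (tsupport_comp_subset Complex.ofReal_zero _).trans ?_
  rw [ψ.tsupport_eq, Real.closedBall_eq_Icc, zero_sub, zero_add]

/-- The symmetric pair is a Weil test function. [folklore] -/
theorem isWeilTest_symPair : IsWeilTest (fun x : ℝ ↦ ((ψ (x - L / 2) + ψ (x + L / 2) : ℝ) : ℂ)) := by
  have hψt := isWeilTest_bump ψ
  have e1 : (fun x : ℝ ↦ ((ψ (x - L / 2) : ℝ) : ℂ)) = weilTranslate (fun x : ℝ ↦ ((ψ x : ℝ) : ℂ)) (L / 2) := by
    funext x; simp [weilTranslate]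
  have e2 : (fun x : ℝ ↦ ((ψ (x + L / 2) : ℝ) : ℂ)) = weilTranslate (fun x : ℝ ↦ ((ψ x : ℝ) : ℂ)) (-(L / 2)) := by
    funext x; simp [weilTranslate]
  have hg1 : IsWeilTest fun x : ℝ ↦ ((ψ (x - L / 2) : ℝ) : ℂ) := by rw [e1]; exact hψt.weilTranslate _
  have hg2 : IsWeilTest fun x : ℝ ↦ ((ψ (x + L / 2) : ℝ) : ℂ) := by rw [e2]; exact hψt.weilTranslate _
  have e : ((fun x : ℝ ↦ ((ψ (x - L / 2) + ψ (x + L / 2) : ℝ) : ℂ))) = (fun x : ℝ ↦ ((ψ (x - L / 2) : ℝ) : ℂ)) + fun x : ℝ ↦ ((ψ (x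
        + L / 2) : ℝ) : ℂ) := by
    funext x; simp only [Pi.add_apply]; push_cast; ring
  rw [e]
  exact hg1.add hg2

/-- Support of the pair: `⊆ [−b, b]` once `r_out + L/2 ≤ b` (`L ≥ 0`). [folklore] -/
theorem tsupport_symPair_subset (hL : 0 ≤ L) {b : ℝ} (hb : ψ.rOut + L / 2 ≤ b) :
    tsupport (fun x : ℝ ↦ ((ψ (x - L / 2) + ψ (x + L / 2) : ℝ) : ℂ)) ⊆ Icc (-b) b := by
  refine closure_minimal ?_ isClosed_Icc
  intro x hx
  have hx' : ψ (x - L / 2) + ψ (x + L / 2) ≠ 0 := fun h0 ↦ hx (by simp only [h0, Complex.ofReal_zero])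
  have hcase : ψ (x - L / 2) ≠ 0 ∨ ψ (x + L / 2) ≠ 0 := by
    by_contra hh
    simp only [not_or, not_not] at hh
    exact hx' (by rw [hh.1, hh.2, add_zero])
  rcases hcase with h | h
  · have := abs_lt_rOut_of_ne_zero ψ h
    rw [abs_lt] at this
    constructor <;> linarith [this.1, this.2]
  · have := abs_lt_rOut_of_ne_zero ψ h
    rw [abs_lt] at this
    constructor <;> linarith [this.1, this.2]

/-- Pointwise square of the pair (disjoint layers): `(ψ(u − L/2) + ψ(u + L/2))² = ψ(u − L/2)² + ψ(u + L/2)²`. [folklore] -/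
theorem symPair_sq (hL : 2 * ψ.rOut ≤ L) (u : ℝ) :
    (ψ (u - L / 2) + ψ (u + L / 2)) ^ 2 = ψ (u - L / 2) ^ 2 + ψ (u + L / 2) ^ 2 := by
  linear_combination (2 : ℝ) * layer_mul_layer_eq_zero ψ hL u

/-- `‖g_L‖₂² = 2‖ψ‖₂²`. [folklore] -/
theorem integral_norm_sq_symPair (hL : 2 * ψ.rOut ≤ L) :
    ∫ u : ℝ, ‖((fun x : ℝ ↦ ((ψ (x - L / 2) + ψ (x + L / 2) : ℝ) : ℂ))) u‖ ^ 2 = 2 * ∫ y : ℝ, ψ y ^ 2 := by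
  have e : (fun u : ℝ ↦ ‖((fun x : ℝ ↦ ((ψ (x - L / 2) + ψ (x + L / 2) : ℝ) : ℂ))) u‖ ^ 2) = fun u : ℝ ↦ ψ (u - L / 2) ^ 2 + ψ (u + L / 2) ^ 2 := by
    funext u
    simp only []
    rw [Complex.norm_real, Real.norm_eq_abs, sq_abs, symPair_sq ψ hL u]
  have hIm : ∫ u : ℝ, ψ (u - L / 2) ^ 2 = ∫ y : ℝ, ψ y ^ 2 :=
    integral_sub_right_eq_self (fun y : ℝ ↦ ψ y ^ 2) (L / 2)
  have hIp : ∫ u : ℝ, ψ (u + L / 2) ^ 2 = ∫ y : ℝ, ψ y ^ 2 :=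
    integral_add_right_eq_self (fun y : ℝ ↦ ψ y ^ 2) (L / 2)
  rw [e, integral_add ((integrable_bump_sq ψ).comp_sub_right (L / 2)) ((integrable_bump_sq ψ).comp_add_right (L / 2)),
    hIm, hIp]
  ring

/-! ## §2  The autocorrelation `φ = ψ ⋆ ψ̃`: real, even, narrow; the kernel of the pair -/

/-- `φ(x) = ∫ ψ(u)ψ(u − x) du` (a real number). [folklore] -/
theorem autocorr_eq (x : ℝ) : (weilConv (fun x : ℝ ↦ ((ψ x : ℝ) : ℂ)) (weilReflect fun x : ℝ ↦ ((ψ x : ℝ) : ℂ))) x = ((∫ u : ℝ, ψ u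
      * ψ (u - x) : ℝ) : ℂ) := by
  rw [weilConv_weilReflect_eq_integral, ← integral_complex_ofReal]
  congr 1 with u
  push_cast
  rw [Complex.conj_ofReal]

/-- `φ` is even. [folklore] -/
theorem autocorr_neg (x : ℝ) : (weilConv (fun x : ℝ ↦ ((ψ x : ℝ) : ℂ)) (weilReflect fun x : ℝ ↦ ((ψ x : ℝ) : ℂ))) (-x) = (weilConv
      (fun x : ℝ ↦ ((ψ x : ℝ) : ℂ)) (weilReflect fun x : ℝ ↦ ((ψ x : ℝ) : ℂ))) x := by
  rw [autocorr_eq, autocorr_eq]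
  congr 1
  simp only [sub_neg_eq_add]
  have h := integral_add_right_eq_self (μ := (volume : Measure ℝ)) (fun v : ℝ ↦ ψ (v - x) * ψ v) x
  simp only [add_sub_cancel_right] at h
  rw [h]
  congr 1 with v
  ring

/-- `φ` is real: `conj φ(x) = φ(x)`. [folklore] -/
theorem conj_autocorr (x : ℝ) : conj ((weilConv (fun x : ℝ ↦ ((ψ x : ℝ) : ℂ)) (weilReflect fun x : ℝ ↦ ((ψ x : ℝ) : ℂ))) x) =
      (weilConv (fun x : ℝ ↦ ((ψ x : ℝ) : ℂ)) (weilReflect fun x : ℝ ↦ ((ψ x : ℝ) : ℂ))) x := by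
  rw [autocorr_eq, Complex.conj_ofReal]

/-- `φ` is a Weil test function. [folklore] -/
theorem isWeilTest_autocorr : IsWeilTest (weilConv (fun x : ℝ ↦ ((ψ x : ℝ) : ℂ)) (weilReflect fun x : ℝ ↦ ((ψ x : ℝ) : ℂ))) :=
  (isWeilTest_bump ψ).weilConv (isWeilTest_bump ψ).weilReflect

/-- `φ` is narrow: `tsupport φ ⊆ [−2r_out, 2r_out]`, so `φ(x) = 0` for `2r_out < |x|`. [folklore] -/
theorem autocorr_eq_zero {x : ℝ} (hx : 2 * ψ.rOut < |x|) : (weilConv (fun x : ℝ ↦ ((ψ x : ℝ) : ℂ)) (weilReflect fun x : ℝ ↦ ((ψ x :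
      ℝ) : ℂ))) x = 0 := by
  have hsub := tsupport_weilConv_weilReflect_subset (isWeilTest_bump ψ).2 (tsupport_bump_subset ψ)
  refine image_eq_zero_of_notMem_tsupport fun hmem ↦ ?_
  have h := hsub hmem
  rw [mem_Icc] at h
  have : |x| ≤ 2 * ψ.rOut := abs_le.2 ⟨h.1, h.2⟩
  linarith

/-- The cross kernel of two translates of the bump: `(ψ(· − a) ⋆ (ψ(· − b))~)(x) = φ(x − (a − b))`. [folklore] -/
theorem weilConv_translate_weilReflect_translate (a b x : ℝ) :
    weilConv (fun y : ℝ ↦ ((ψ (y - a) : ℝ) : ℂ)) (weilReflect fun y : ℝ ↦ ((ψ (y - b) : ℝ) : ℂ)) x =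
      (weilConv (fun x : ℝ ↦ ((ψ x : ℝ) : ℂ)) (weilReflect fun x : ℝ ↦ ((ψ x : ℝ) : ℂ))) (x - (a - b)) := by
  rw [weilConv_weilReflect_eq_integral, weilConv_weilReflect_eq_integral]
  have h := integral_sub_right_eq_self (μ := (volume : Measure ℝ))
    (fun u : ℝ ↦ ((ψ u : ℝ) : ℂ) * conj (((ψ (u - (x - (a - b))) : ℝ) : ℂ))) a
  rw [← h]
  congr 1 with u
  congr 3
  ring

/-- **The kernel of the symmetric pair**: `k_{g_L} = 2φ + φ(· − L) + φ(· + L)`. [folklore] -/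
theorem weilConv_weilReflect_symPair :
    weilConv (fun x : ℝ ↦ ((ψ (x - L / 2) + ψ (x + L / 2) : ℝ) : ℂ)) (weilReflect (fun x : ℝ ↦ ((ψ (x - L / 2) + ψ (x + L / 2) : ℝ)
          : ℂ))) = fun x ↦ 2 * (weilConv (fun x : ℝ ↦ ((ψ x : ℝ) : ℂ)) (weilReflect fun x : ℝ ↦ ((ψ x : ℝ) : ℂ))) x + ((weilConv
          (fun x : ℝ ↦ ((ψ x : ℝ) : ℂ)) (weilReflect fun x : ℝ ↦ ((ψ x : ℝ) : ℂ))) (x - L) + (weilConv (fun x : ℝ ↦ ((ψ x : ℝ) : ℂ))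
          (weilReflect fun x : ℝ ↦ ((ψ x : ℝ) : ℂ))) (x + L)) := by
  have hψt := isWeilTest_bump ψ
  set h1 : ℝ → ℂ := fun y ↦ ((ψ (y - L / 2) : ℝ) : ℂ) with hh1
  set h2 : ℝ → ℂ := fun y ↦ ((ψ (y - (-(L / 2))) : ℝ) : ℂ) with hh2
  have e1 : h1 = weilTranslate (fun x : ℝ ↦ ((ψ x : ℝ) : ℂ)) (L / 2) := by funext x; simp [hh1, weilTranslate]
  have e2 : h2 = weilTranslate (fun x : ℝ ↦ ((ψ x : ℝ) : ℂ)) (-(L / 2)) := by funext x; simp [hh2, weilTranslate]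
  have hh1t : IsWeilTest h1 := by rw [e1]; exact hψt.weilTranslate _
  have hh2t : IsWeilTest h2 := by rw [e2]; exact hψt.weilTranslate _
  have e : ((fun x : ℝ ↦ ((ψ (x - L / 2) + ψ (x + L / 2) : ℝ) : ℂ))) = h1 + h2 := by
    funext x; simp only [hh1, hh2, Pi.add_apply, sub_neg_eq_add]; push_cast; ring
  rw [e, weilConv_weilReflect_add hh1t hh2t]
  funext x
  simp only [Pi.add_apply, hh1, hh2]
  rw [weilConv_translate_weilReflect_translate ψ (L / 2) (L / 2) x,
    weilConv_translate_weilReflect_translate ψ (-(L / 2)) (-(L / 2)) x,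
    weilConv_translate_weilReflect_translate ψ (L / 2) (-(L / 2)) x,
    weilConv_translate_weilReflect_translate ψ (-(L / 2)) (L / 2) x]
  have ea : x - (L / 2 - L / 2) = x := by ring
  have eb : x - (-(L / 2) - -(L / 2)) = x := by ring
  have ec : x - (L / 2 - -(L / 2)) = x - L := by ring
  have ed : x - (-(L / 2) - L / 2) = x + L := by ring
  rw [ea, eb, ec, ed]
  ring

end Summit.RiemannHypothesis.RiemannHypothesis.Theorems.HandoffBumpAutocorr

end
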